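import Summits.PneNP.PneNP.Theorems.ExpanderLinearGeneratorsExpansionForcesDepthFregeSizeEightReduction
import Literature.Computability.MetaComplexity.ExpanderTreewidth

/-!
# PneNP / ExpanderLinearGenerators — the unsolvable core of an expanding system has a row graph
of linear treewidth (stmt-PneNP-11442, calibration helper)

Route `PneNP/ExpanderLinearGenerators`, support item stmt-PneNP-11442
(`Summit.PneNP.PneNP.Theses.ExpanderLinearGenerators.ExpansionForcesDepthFregeSize`). The item is
in print at column weight `2` (graph Tseitin formulas), where depth-`d` Frege refutations have size
`2^{tw(G)^{Ω(1/d)}}` (Galesi–Itsykson–Riazanov–Sofronova 2023, Håstad 2020) — PROVIDED the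
`(r, 3/4 · ℓ)`-boundary expansion of the hypothesis forces treewidth `Ω(r)`. This file records that
step for arbitrary column weight, in the item's vocabulary:

* `inter_supp_nonempty_of_inter_map_nonempty` — scopes `supp(E_i)` read in `ℕ` intersect iff the
  supports intersect;
* `le_treewidth_of_boundary_eq_empty` — if the row supports of an `ℓ`-sparse system (`ℓ ≥ 1`) form
  an `(r, 3/4 · ℓ)`-boundary expander and `U` is a nonempty row set with empty boundary, then every
  graph on `U` in which rows with intersecting supports are adjacent has treewidth
  `≥ 3(r - 1)/8 - 1` (`Literature.Computability.MetaComplexity.mul_le_mul_treewidth_of_isBoundaryExpander`);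
* `exists_core_le_treewidth_of_not_systemSat` — an unsolvable such system has a nonempty
  boundaryless row set (`exists_boundary_eq_empty_of_not_systemSat`), hence one whose row graphs
  all have treewidth `≥ 3(r - 1)/8 - 1`.

References: Galesi–Itsykson–Riazanov–Sofronova, Ann. Pure Appl. Logic 174 (2023) [GalesiEtAl2023];
Ben-Sasson–Wigderson, J. ACM 48 (2001) §5 [BenSassonWigderson2001].
-/

namespace Summit.PneNP.PneNP.Theorems

set_option linter.dupNamespace false -- `Summit.PneNP.PneNP.…`: summit = sub-problem (D-0017)

open Finset Literature.Computability.MetaComplexity Literature.Combinatorics.SimpleGraph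

/-- Row scopes read in `ℕ` intersect only if the supports intersect. [folklore] -/
theorem inter_supp_nonempty_of_inter_map_nonempty {p n : ℕ} (A B : LinEqMod p n)
    (h : (A.supp.map Fin.valEmbedding ∩ B.supp.map Fin.valEmbedding).Nonempty) :
    (A.supp ∩ B.supp).Nonempty := by
  obtain ⟨x, hx⟩ := h
  rw [Finset.mem_inter] at hx
  obtain ⟨j, hj, rfl⟩ := Finset.mem_map.1 hx.1
  obtain ⟨j', hj', hjj'⟩ := Finset.mem_map.1 hx.2
  have : j' = j := Fin.valEmbedding.injective hjj'
  subst this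
  exact ⟨j', Finset.mem_inter.2 ⟨hj, hj'⟩⟩

/-- **A boundaryless row set of an expanding system has a row graph of linear treewidth.** If the
row supports of an `ℓ`-sparse system `E` over `𝔽_p` (`ℓ ≥ 1`) form an `(r, 3/4 · ℓ)`-boundary
expander and `U` is a nonempty set of rows with empty boundary (every variable of a row of `U`
occurs in another row of `U`), then every graph on `U` in which rows with intersecting supports
are adjacent satisfies `3(r - 1)/8 ≤ tw + 1`. [cite: GalesiEtAl2023, §1] -/
theorem le_treewidth_of_boundary_eq_empty {p m n ℓ : ℕ} (E : Fin m → LinEqMod p n) (hℓ : 1 ≤ ℓ)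
    (hsparse : ∀ i, (E i).supp.card ≤ ℓ) {r : ℝ}
    (hexp : IsBoundaryExpander (fun i => (E i).supp.map Fin.valEmbedding) r (3 / 4 * ℓ))
    (U : Finset (Fin m)) (hU : U.Nonempty)
    (hUcl : boundary (fun i => (E i).supp.map Fin.valEmbedding) U = ∅)
    (G : SimpleGraph U) (hG : ∀ a b : U, a ≠ b → ((E a).supp ∩ (E b).supp).Nonempty → G.Adj a b) :
    3 * (r - 1) / 8 ≤ (treewidth G + 1 : ℕ) := by
  classical
  haveI : Nonempty U := hU.to_subtype
  set T : Fin m → Finset ℕ := fun i => (E i).supp.map Fin.valEmbedding with hT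
  set f : U ↪ Fin m := Function.Embedding.subtype (· ∈ U) with hf
  have hℓ' : ∀ a : U, ((T ∘ f) a).card ≤ ℓ := fun a => by
    simp only [Function.comp_apply, hT, Finset.card_map]
    exact hsparse _
  have hc : (0 : ℝ) < 3 / 4 * ℓ := by
    have : (1 : ℝ) ≤ ℓ := by exact_mod_cast hℓ
    positivity
  have hexp' : IsBoundaryExpander (T ∘ f) r (3 / 4 * ℓ) := hexp.comp_of_injective f
  have hcl' : boundary (T ∘ f) Finset.univ = ∅ := by
    rw [boundary_comp_eq T f, Finset.univ_eq_attach, hf, Finset.attach_map_val]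
    exact hUcl
  have hG' : ∀ a b : U, a ≠ b → ((T ∘ f) a ∩ (T ∘ f) b).Nonempty → G.Adj a b := fun a b hab h =>
    hG a b hab (inter_supp_nonempty_of_inter_map_nonempty _ _ h)
  have key := mul_le_mul_treewidth_of_isBoundaryExpander hℓ' hc hexp' hcl' G hG'
  -- divide `3/4 ℓ (r - 1) / 2 ≤ ℓ (tw + 1)` by `ℓ > 0`
  have hℓ0 : (0 : ℝ) < ℓ := by exact_mod_cast hℓ
  have key' : (ℓ : ℝ) * (3 * (r - 1) / 8) ≤ ℓ * (treewidth G + 1 : ℕ) := by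
    calc (ℓ : ℝ) * (3 * (r - 1) / 8) = 3 / 4 * ℓ * (r - 1) / 2 := by ring
      _ ≤ _ := key
  exact le_of_mul_le_mul_left key' hℓ0

/-- **The unsolvable core has linear treewidth.** An unsolvable `ℓ`-sparse system over `𝔽₂`
(`ℓ ≥ 1`) whose row supports form an `(r, 3/4 · ℓ)`-boundary expander has a nonempty row set `U`
with empty boundary all of whose row graphs (rows with intersecting supports adjacent) satisfy
`3(r - 1)/8 ≤ tw + 1`. At column weight `2` (`U` = a set of vertices of a graph of maximum degree
`≤ ℓ`, rows adjacent iff the vertices are) this is the treewidth hypothesis of the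
Galesi–Itsykson–Riazanov–Sofronova lower bound. [cite: GalesiEtAl2023, §1] -/
theorem exists_core_le_treewidth_of_not_systemSat {m n ℓ : ℕ} (E : Fin m → LinEqMod 2 n)
    (hℓ : 1 ≤ ℓ) (hsparse : ∀ i, (E i).supp.card ≤ ℓ) {r : ℝ}
    (hexp : IsBoundaryExpander (fun i => (E i).supp.map Fin.valEmbedding) r (3 / 4 * ℓ))
    (hunsat : ¬ SystemSat E Finset.univ) :
    ∃ U : Finset (Fin m), U.Nonempty ∧
      boundary (fun i => (E i).supp.map Fin.valEmbedding) U = ∅ ∧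
      ∀ G : SimpleGraph U, (∀ a b : U, a ≠ b → ((E a).supp ∩ (E b).supp).Nonempty → G.Adj a b) →
        3 * (r - 1) / 8 ≤ (treewidth G + 1 : ℕ) := by
  obtain ⟨U, hU, hUcl⟩ := exists_boundary_eq_empty_of_not_systemSat E hunsat
  exact ⟨U, hU, hUcl, fun G hG => le_treewidth_of_boundary_eq_empty E hℓ hsparse hexp U hU hUcl G hG⟩

end Summit.PneNP.PneNP.Theorems
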